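import Summits.QuantumAdvantage.QuantumAdvantage.Theorems.FanInRootDefs

/-!
# FanInRoot (4/11): the hub game in DEGREE form (`hubInst`, `HubLosesDeg`) and junta ⟹ degree (`hubLoses_of_hubLosesDeg`)
-/

set_option linter.dupNamespace false -- D-0017: single-problem summit ⇒ `QuantumAdvantage.QuantumAdvantage` by design

namespace Summit.QuantumAdvantage.QuantumAdvantage.Theorems.FanInRoot

open Finset
open Summit.QuantumAdvantage.AdviceFreeQNC0
open Literature.Computability.QuantumComplexity
open Literature.Computability.QuantumComplexity.RingHLF
open Literature.Computability.MetaComplexity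
open scoped Classical

/-! ### §6c The hub game IN DEGREE FORM and the COLLAPSE LAW (elementary support) -/

/-- The hub instance `x^β`: background `0`, the `a`-th hub (in increasing order) carries `β_a`. -/
def hubInst {n : ℕ} (H : Finset (Fin n)) (β : Fin H.card → Bool) : Fin n → Bool :=
  fun i => if h : i ∈ H then β ((H.orderIsoOfFin rfl).symm ⟨i, h⟩) else false

/-- FanInRoot helper `hubInst_supported` (lens-1 g6 FanInRoot package; see the module docstring). -/
theorem hubInst_supported {n : ℕ} (H : Finset (Fin n)) (β : Fin H.card → Bool) : hubInst H β ∈ HubSupported H :=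
  fun i hi => by simp [hubInst, hi]

/-- FanInRoot helper `hubInst_mem` (lens-1 g6 FanInRoot package; see the module docstring). -/
theorem hubInst_mem {n : ℕ} (H : Finset (Fin n)) (β : Fin H.card → Bool) {i : Fin n} (hi : i ∈ H) :
    hubInst H β i = β ((H.orderIsoOfFin rfl).symm ⟨i, hi⟩) := by simp [hubInst, hi]

/-- **`H ∈ HubLosesDeg n r`** (degree form of `HubLoses`): every strategy whose outputs, as functions of the hub pattern `β` (on hub-supported inputs), are
`𝔽₂`-polynomials of degree `≤ r` loses an odd-class hub instance.  [NEW notion] -/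
def HubLosesDeg (n r : ℕ) : Set (Finset (Fin n)) := {H |
  ∀ z : (Fin n → Bool) → Fin n → Bool,
    (∀ j : Fin n, (fun β : Fin H.card → Bool => if z (hubInst H β) j = true then (1 : ZMod 2) else 0) ∈ Smolensky.lowDeg (ZMod 2) H.card r) →
      ∃ x : Fin n → Bool, x ∈ HubSupported H ∧ OddZeros x ∧ ¬ Rel x (z x) }

/-- Junta ⟹ degree: `H ∈ HubLosesDeg n r → H ∈ HubLoses n r` (an output reading `≤ r` hubs is, on hub-supported inputs, an `r`-junta of `β`, hence of `𝔽₂`-degree `≤ r`: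
`AffBells22.indicator_mem_lowDeg`). [PROVED glue] -/
theorem hubLoses_of_hubLosesDeg {n : ℕ} {H : Finset (Fin n)} {r : ℕ} (h : H ∈ HubLosesDeg n r) : H ∈ HubLoses n r := by
  classical
  intro z hz
  refine h z fun j => ?_
  obtain ⟨R, hRH, hRc, hR⟩ := hz j
  let e := H.orderIsoOfFin rfl
  let R' : Finset (Fin H.card) := univ.filter fun a => (e a).1 ∈ R
  have hread : AffBells22.ReadsOnly R' (fun β : Fin H.card → Bool => z (hubInst H β) j) := by
    intro β β' hββ'
    refine hR _ _ (hubInst_supported H β) (hubInst_supported H β') fun i hi => ?_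
    have hiH : i ∈ H := hRH hi
    rw [hubInst_mem H β hiH, hubInst_mem H β' hiH]
    apply hββ'
    simp only [R', mem_filter, mem_univ, true_and, e, OrderIso.apply_symm_apply]
    exact hi
  have hcard : R'.card ≤ r := by
    refine le_trans (Finset.card_le_card_of_injOn (fun a => (e a).1) (fun a ha => ?_) ?_) hRc
    · simpa [R'] using ha
    · intro a _ b _ hab
      exact e.injective (Subtype.ext hab)
  exact Smolensky.lowDeg_mono hcard (AffBells22.indicator_mem_lowDeg R' _ hread)

end Summit.QuantumAdvantage.QuantumAdvantage.Theorems.FanInRoot
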